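/-
Copyright (c) 2026 the pub-hodgecm-mathlib formalisation cell (harness21).  Prover seat hodgecm-mathlib-K2E5-p16 (g6), Track B «K2-LIT»,
#184♮ = hLiu418 = `stmt-HodgeConjecture-24832`; row `K2LiuArchIntertwiningLieEquivariance` (LEAD F0P6-plan (g13) 10:13:40Z ∕ (g14) BATCH #1),
letter file (L-i) for (A) `K2LiuArchIntertwiningLieDerivative`: UNIFORM RESOLVENT BOUNDS `‖(X + Z)⁻¹‖ ≤ C(Z)` on the `Herm₂(ℂ)`-tube and their
stability under small perturbations of `Z`.  THEOREMS ONLY (no `def`, no `instance`, no notation, no named-fact hypothesis, no `sorry`; no matrix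
norm in any statement — all bounds are ENTRYWISE).
-/
import Summits.HodgeConjecture.HodgeConjecture.Theorems.K2LiuHermTwoGammaDefs   -- ★ `hermTwo`, `posDef_hermTwo_iff`, `hermTwo_eq_of_isHermitian`
import Mathlib.LinearAlgebra.Matrix.NonsingularInverse
import Mathlib.Analysis.SpecialFunctions.Pow.Real
import HarnessLib

/-!
# Crux `HLiu418`, A∞ organ: uniform resolvent bounds on the Hermitian tube (`2 × 2`)

Cell `hodgecm-mathlib`, crux item hLiu418 = `stmt-HodgeConjecture-24832` (helper lane `--supports`, count-neutral).

For the swap lemma (A) «`d∕dt ∫_{Herm₂} f⁰_{s,k}(J·n(X)·g·γ_t) dX = ∫ ∂_t …`» one needs a majorant of `∂_t f⁰_{s,k}(J n(X) g γ_t)` that is UNIFORM for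
`t` near `0`.  With `Z_t = (gγ_t)·(i1) = U_t + iV_t` the integrand is governed by `det(X + Z_t)` and the logarithmic derivative by
`(X + Z_t)⁻¹`.  This file supplies the two matrix letters, for `2 × 2` complex matrices and with ENTRYWISE bounds only:
* §1 an entrywise-bound toolkit (`mul`, `trace`, `det`, `adjugate`, inverse, `det (1 + N) ≥ ¼`, `(1 + N)⁻¹`);
* §2 the Hermitian resolvent at the base point: for Hermitian `Y`, `|det(Y + i)|² = (ab − |z|²)² + a² + b² + 1 + 2|z|²`, hence
  `1 ≤ |det(Y + i)|` and every entry of `(Y + i)⁻¹` has modulus `≤ 1`;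
* §3 a Cholesky factor `V = Bᴴ B` of a positive definite `V` (explicit, `2 × 2`);
* §4 at a tube point `Z = U + iV`: `X + Z = Bᴴ (Y + i) B` with `Y = B⁻ᴴ (X + U) B⁻¹` Hermitian, so `|det(X + Z)| ≥ |det B|² > 0` and the entries of
  `(X + Z)⁻¹ = B⁻¹ (Y + i)⁻¹ B⁻ᴴ` are bounded UNIFORMLY in the Hermitian matrix `X` (`exists_resolvent_bound`);
* §5 PERTURBATION: for `‖E‖_∞ ≤ η(Z)`, `|det(X + Z)| ≤ 4·|det(X + Z + E)|` and the entries of `(X + Z + E)⁻¹` stay uniformly bounded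
  (`exists_resolvent_perturb`) — `X + Z + E = (X + Z)(1 + N)`, `N = (X + Z)⁻¹ E` small, `det(1 + N) = 1 + tr N + det N`.
No eigenvalues, no numerical range, no Loewner monotonicity are used.
References: [Shimura1982, §1 (1.26)] (the role of `det(x + iy)`), folklore linear algebra.
HONEST LABEL: HC_CM is proved only modulo the 7 printed citations (2 remaining named inputs: hLiu418 = stmt-HodgeConjecture-24832,
h413 = stmt-HodgeConjecture-24833) until rung 0 closes; count-neutral helper, closes no socket.
-/

set_option autoImplicit false
set_option linter.dupNamespace false

noncomputable section

open Complex Matrix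
open scoped ComplexConjugate ComplexOrder

namespace Summit.HodgeConjecture.HodgeConjecture.Cruxes.HLiu418.K2LiuHermTwoResolventBounds

open Summit.HodgeConjecture.HodgeConjecture.Cruxes.HLiu418.K2LiuHermTwoGammaDefs

/-! ## §1  Entrywise-bound toolkit for `2 × 2` complex matrices -/

/-- An entrywise bound is nonnegative. [folklore] -/
theorem bound_nonneg {M : Matrix (Fin 2) (Fin 2) ℂ} {a : ℝ} (hM : ∀ i j, ‖M i j‖ ≤ a) : 0 ≤ a :=
  (norm_nonneg _).trans (hM 0 0)

/-- Entries of a product: `‖(M N)ᵢⱼ‖ ≤ 2ab`. [folklore] -/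
theorem norm_mul_apply_le {M N : Matrix (Fin 2) (Fin 2) ℂ} {a b : ℝ} (hM : ∀ i j, ‖M i j‖ ≤ a) (hN : ∀ i j, ‖N i j‖ ≤ b)
    (i j : Fin 2) : ‖(M * N) i j‖ ≤ 2 * a * b := by
  have ha := bound_nonneg hM
  rw [Matrix.mul_apply, Fin.sum_univ_two]
  calc ‖M i 0 * N 0 j + M i 1 * N 1 j‖ ≤ ‖M i 0‖ * ‖N 0 j‖ + ‖M i 1‖ * ‖N 1 j‖ := by
        refine (norm_add_le _ _).trans ?_
        rw [norm_mul, norm_mul]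
    _ ≤ a * b + a * b := by
        gcongr <;> first | exact hM _ _ | exact hN _ _
    _ = 2 * a * b := by ring

/-- Entries of a sum. [folklore] -/
theorem norm_add_apply_le {M N : Matrix (Fin 2) (Fin 2) ℂ} {a b : ℝ} (hM : ∀ i j, ‖M i j‖ ≤ a) (hN : ∀ i j, ‖N i j‖ ≤ b)
    (i j : Fin 2) : ‖(M + N) i j‖ ≤ a + b := by
  rw [Matrix.add_apply]
  exact (norm_add_le _ _).trans (add_le_add (hM i j) (hN i j))

/-- Entries of a difference. [folklore] -/
theorem norm_sub_apply_le {M N : Matrix (Fin 2) (Fin 2) ℂ} {a b : ℝ} (hM : ∀ i j, ‖M i j‖ ≤ a) (hN : ∀ i j, ‖N i j‖ ≤ b)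
    (i j : Fin 2) : ‖(M - N) i j‖ ≤ a + b := by
  rw [Matrix.sub_apply]
  exact (norm_sub_le _ _).trans (add_le_add (hM i j) (hN i j))

/-- The trace: `‖tr M‖ ≤ 2a`. [folklore] -/
theorem norm_trace_le {M : Matrix (Fin 2) (Fin 2) ℂ} {a : ℝ} (hM : ∀ i j, ‖M i j‖ ≤ a) : ‖M.trace‖ ≤ 2 * a := by
  rw [Matrix.trace_fin_two]
  calc ‖M 0 0 + M 1 1‖ ≤ ‖M 0 0‖ + ‖M 1 1‖ := norm_add_le _ _
    _ ≤ a + a := add_le_add (hM 0 0) (hM 1 1)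
    _ = 2 * a := by ring

/-- The determinant: `‖det M‖ ≤ 2a²`. [folklore] -/
theorem norm_det_le {M : Matrix (Fin 2) (Fin 2) ℂ} {a : ℝ} (hM : ∀ i j, ‖M i j‖ ≤ a) : ‖M.det‖ ≤ 2 * a ^ 2 := by
  have ha := bound_nonneg hM
  rw [Matrix.det_fin_two]
  calc ‖M 0 0 * M 1 1 - M 0 1 * M 1 0‖ ≤ ‖M 0 0‖ * ‖M 1 1‖ + ‖M 0 1‖ * ‖M 1 0‖ := by
        refine (norm_sub_le _ _).trans ?_
        rw [norm_mul, norm_mul]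
    _ ≤ a * a + a * a := by gcongr <;> exact hM _ _
    _ = 2 * a ^ 2 := by ring

/-- The adjugate has the same entrywise bound (`2 × 2`: its entries are `±` entries of `M`). [folklore] -/
theorem norm_adjugate_apply_le {M : Matrix (Fin 2) (Fin 2) ℂ} {a : ℝ} (hM : ∀ i j, ‖M i j‖ ≤ a) (i j : Fin 2) :
    ‖M.adjugate i j‖ ≤ a := by
  rw [Matrix.adjugate_fin_two]
  fin_cases i <;> fin_cases j <;> simp only [Fin.zero_eta, Fin.isValue, Fin.mk_one, of_apply, cons_val', cons_val_zero, cons_val_one,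
    cons_val_fin_one, empty_val', norm_neg] <;> exact hM _ _

/-- The inverse: if `0 < δ ≤ ‖det M‖` then `‖(M⁻¹)ᵢⱼ‖ ≤ a ∕ δ`. [folklore] -/
theorem norm_inv_apply_le {M : Matrix (Fin 2) (Fin 2) ℂ} {a δ : ℝ} (hM : ∀ i j, ‖M i j‖ ≤ a) (hδ : 0 < δ) (hdet : δ ≤ ‖M.det‖)
    (i j : Fin 2) : ‖M⁻¹ i j‖ ≤ a / δ := by
  have ha := bound_nonneg hM
  rw [Matrix.inv_def, Ring.inverse_eq_inv, Matrix.smul_apply, smul_eq_mul, norm_mul, norm_inv, div_eq_inv_mul]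
  exact mul_le_mul (by rwa [inv_le_inv₀ (hδ.trans_le hdet) hδ]) (norm_adjugate_apply_le hM i j) (norm_nonneg _)
    (inv_nonneg.mpr hδ.le)

/-- Entries of the identity. [folklore] -/
theorem norm_one_apply_le (i j : Fin 2) : ‖(1 : Matrix (Fin 2) (Fin 2) ℂ) i j‖ ≤ 1 := by
  rw [Matrix.one_apply]
  split_ifs <;> simp

/-- Entries of `star`-transposes keep their bound. [folklore] -/
theorem norm_conjTranspose_apply_le {M : Matrix (Fin 2) (Fin 2) ℂ} {a : ℝ} (hM : ∀ i j, ‖M i j‖ ≤ a) (i j : Fin 2) :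
    ‖Mᴴ i j‖ ≤ a := by
  rw [conjTranspose_apply, Complex.star_def, Complex.norm_conj]
  exact hM j i

/-- Every matrix has SOME entrywise bound: the sum of the moduli of its entries. [folklore] -/
theorem norm_apply_le_sum (M : Matrix (Fin 2) (Fin 2) ℂ) (i j : Fin 2) :
    ‖M i j‖ ≤ ‖M 0 0‖ + ‖M 0 1‖ + ‖M 1 0‖ + ‖M 1 1‖ := by
  have h00 := norm_nonneg (M 0 0)
  have h01 := norm_nonneg (M 0 1)
  have h10 := norm_nonneg (M 1 0)
  have h11 := norm_nonneg (M 1 1)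
  fin_cases i <;> fin_cases j <;> simp only [Fin.zero_eta, Fin.isValue, Fin.mk_one] <;> linarith

/-- **`det(1 + N)` stays away from `0` for small `N`**: if `‖Nᵢⱼ‖ ≤ ν ≤ ¼` then `¼ ≤ ‖det(1 + N)‖`
(`det(1 + N) = 1 + tr N + det N`, `2 × 2`). [folklore] -/
theorem norm_det_one_add_ge {N : Matrix (Fin 2) (Fin 2) ℂ} {ν : ℝ} (hN : ∀ i j, ‖N i j‖ ≤ ν) (hν : ν ≤ 1 / 4) :
    1 / 4 ≤ ‖(1 + N).det‖ := by
  have hν0 := bound_nonneg hN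
  have hexp : (1 + N).det = 1 + (N 0 0 + N 1 1 + (N 0 0 * N 1 1 - N 0 1 * N 1 0)) := by
    rw [Matrix.det_fin_two]
    simp only [Matrix.add_apply, Matrix.one_apply_eq, Matrix.one_apply_ne (show (0 : Fin 2) ≠ 1 by decide),
      Matrix.one_apply_ne (show (1 : Fin 2) ≠ 0 by decide), zero_add]
    ring
  have hsmall : ‖N 0 0 + N 1 1 + (N 0 0 * N 1 1 - N 0 1 * N 1 0)‖ ≤ 2 * ν + 2 * ν ^ 2 := by
    calc ‖N 0 0 + N 1 1 + (N 0 0 * N 1 1 - N 0 1 * N 1 0)‖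
        ≤ ‖N 0 0‖ + ‖N 1 1‖ + (‖N 0 0‖ * ‖N 1 1‖ + ‖N 0 1‖ * ‖N 1 0‖) := by
          refine (norm_add_le _ _).trans (add_le_add (norm_add_le _ _) ?_)
          refine (norm_sub_le _ _).trans ?_
          rw [norm_mul, norm_mul]
      _ ≤ ν + ν + (ν * ν + ν * ν) := by gcongr <;> exact hN _ _
      _ = 2 * ν + 2 * ν ^ 2 := by ring
  have h34 : 2 * ν + 2 * ν ^ 2 ≤ 3 / 4 := by nlinarith
  rw [hexp]
  have h := norm_sub_norm_le (1 : ℂ) (-(N 0 0 + N 1 1 + (N 0 0 * N 1 1 - N 0 1 * N 1 0)))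
  rw [sub_neg_eq_add, norm_neg, norm_one] at h
  linarith

/-- **`(1 + N)⁻¹` is entrywise bounded by `5` for `‖Nᵢⱼ‖ ≤ ¼`.** [folklore] -/
theorem norm_inv_one_add_apply_le {N : Matrix (Fin 2) (Fin 2) ℂ} {ν : ℝ} (hN : ∀ i j, ‖N i j‖ ≤ ν) (hν : ν ≤ 1 / 4) (i j : Fin 2) :
    ‖(1 + N)⁻¹ i j‖ ≤ 5 := by
  have h1N : ∀ i j, ‖(1 + N) i j‖ ≤ 1 + ν := norm_add_apply_le norm_one_apply_le hN
  have h := norm_inv_apply_le h1N (by norm_num : (0 : ℝ) < 1 / 4) (norm_det_one_add_ge hN hν) i j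
  have : (1 + ν) / (1 / 4) ≤ 5 := by
    rw [div_le_iff₀ (by norm_num : (0 : ℝ) < 1 / 4)]
    linarith
  exact h.trans this

/-! ## §2  The Hermitian resolvent at the base point `i·1` -/

/-- `|det(Y + i)|²` for `Y = hermTwo (a, z, b)`: `(ab − |z|²)² + a² + b² + 1 + 2|z|²`. [folklore] -/
theorem normSq_det_hermTwo_add_I (c : ℝ × ℂ × ℝ) :
    Complex.normSq ((hermTwo c + I • (1 : Matrix (Fin 2) (Fin 2) ℂ)).det) =
      (c.1 * c.2.2 - Complex.normSq c.2.1) ^ 2 + c.1 ^ 2 + c.2.2 ^ 2 + 1 + 2 * Complex.normSq c.2.1 := by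
  have hdet : (hermTwo c + I • (1 : Matrix (Fin 2) (Fin 2) ℂ)).det =
      ((c.1 * c.2.2 - Complex.normSq c.2.1 - 1 : ℝ) : ℂ) + ((c.1 + c.2.2 : ℝ) : ℂ) * I := by
    rw [Matrix.det_fin_two]
    simp only [Matrix.add_apply, Matrix.smul_apply, Matrix.one_apply_eq, Matrix.one_apply_ne (show (0 : Fin 2) ≠ 1 by decide),
      Matrix.one_apply_ne (show (1 : Fin 2) ≠ 0 by decide), hermTwo_apply_zero_zero, hermTwo_apply_zero_one, hermTwo_apply_one_zero,
      hermTwo_apply_one_one, smul_eq_mul, mul_one, mul_zero, add_zero]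
    rw [show (c.2.1 * conj c.2.1 : ℂ) = ((Complex.normSq c.2.1 : ℝ) : ℂ) from Complex.mul_conj c.2.1]
    push_cast
    ring_nf
    rw [Complex.I_sq]
    ring
  rw [hdet, Complex.normSq_add_mul_I]
  ring

/-- **`1 ≤ |det(Y + i)|`** for Hermitian `Y` (`2 × 2`). [folklore] -/
theorem one_le_norm_det_add_I {Y : Matrix (Fin 2) (Fin 2) ℂ} (hY : Y.IsHermitian) :
    1 ≤ ‖(Y + I • (1 : Matrix (Fin 2) (Fin 2) ℂ)).det‖ := by
  rw [← hermTwo_eq_of_isHermitian hY]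
  set c : ℝ × ℂ × ℝ := ((Y 0 0).re, Y 0 1, (Y 1 1).re)
  have hsq : 1 ≤ ‖(hermTwo c + I • (1 : Matrix (Fin 2) (Fin 2) ℂ)).det‖ ^ 2 := by
    rw [Complex.sq_norm, normSq_det_hermTwo_add_I]
    nlinarith [Complex.normSq_nonneg c.2.1, sq_nonneg (c.1 * c.2.2 - Complex.normSq c.2.1), sq_nonneg c.1, sq_nonneg c.2.2]
  nlinarith [norm_nonneg ((hermTwo c + I • (1 : Matrix (Fin 2) (Fin 2) ℂ)).det)]

/-- Every entry of `Y + i` is dominated by `|det(Y + i)|` (Hermitian `Y`, `2 × 2`). [folklore] -/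
theorem norm_add_I_apply_le_norm_det {Y : Matrix (Fin 2) (Fin 2) ℂ} (hY : Y.IsHermitian) (i j : Fin 2) :
    ‖(Y + I • (1 : Matrix (Fin 2) (Fin 2) ℂ)) i j‖ ≤ ‖(Y + I • (1 : Matrix (Fin 2) (Fin 2) ℂ)).det‖ := by
  rw [← hermTwo_eq_of_isHermitian hY]
  set c : ℝ × ℂ × ℝ := ((Y 0 0).re, Y 0 1, (Y 1 1).re)
  rw [← abs_norm, ← abs_norm ((hermTwo c + _).det), ← sq_le_sq, Complex.sq_norm, Complex.sq_norm, normSq_det_hermTwo_add_I]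
  have hz := Complex.normSq_nonneg c.2.1
  have hsq := sq_nonneg (c.1 * c.2.2 - Complex.normSq c.2.1)
  fin_cases i <;> fin_cases j
  · simp only [Fin.zero_eta, Fin.isValue, Matrix.add_apply, hermTwo_apply_zero_zero, Matrix.smul_apply, Matrix.one_apply_eq,
      smul_eq_mul, mul_one]
    have : Complex.normSq ((c.1 : ℂ) + I) = c.1 ^ 2 + 1 := by
      rw [show ((c.1 : ℂ) + I) = (c.1 : ℂ) + (1 : ℝ) * I by simp, Complex.normSq_add_mul_I]; ring
    rw [this]
    nlinarith [sq_nonneg c.2.2]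
  · simp only [Fin.zero_eta, Fin.isValue, Fin.mk_one, Matrix.add_apply, hermTwo_apply_zero_one, Matrix.smul_apply,
      Matrix.one_apply_ne (show (0 : Fin 2) ≠ 1 by decide), smul_zero, add_zero]
    nlinarith [sq_nonneg c.1, sq_nonneg c.2.2]
  · simp only [Fin.mk_one, Fin.isValue, Fin.zero_eta, Matrix.add_apply, hermTwo_apply_one_zero, Matrix.smul_apply,
      Matrix.one_apply_ne (show (1 : Fin 2) ≠ 0 by decide), smul_zero, add_zero, Complex.normSq_conj]
    nlinarith [sq_nonneg c.1, sq_nonneg c.2.2]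
  · simp only [Fin.mk_one, Fin.isValue, Matrix.add_apply, hermTwo_apply_one_one, Matrix.smul_apply, Matrix.one_apply_eq, smul_eq_mul,
      mul_one]
    have : Complex.normSq ((c.2.2 : ℂ) + I) = c.2.2 ^ 2 + 1 := by
      rw [show ((c.2.2 : ℂ) + I) = (c.2.2 : ℂ) + (1 : ℝ) * I by simp, Complex.normSq_add_mul_I]; ring
    rw [this]
    nlinarith [sq_nonneg c.1]

/-- **Every entry of `(Y + i)⁻¹` has modulus `≤ 1`** for Hermitian `Y` (`2 × 2`): `(Y + i)⁻¹ = adj(Y + i) ∕ det(Y + i)` and the adjugate's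
entries are `±` entries of `Y + i`. [folklore] -/
theorem norm_inv_add_I_apply_le_one {Y : Matrix (Fin 2) (Fin 2) ℂ} (hY : Y.IsHermitian) (i j : Fin 2) :
    ‖(Y + I • (1 : Matrix (Fin 2) (Fin 2) ℂ))⁻¹ i j‖ ≤ 1 := by
  set M : Matrix (Fin 2) (Fin 2) ℂ := Y + I • 1 with hM
  have hdet : 1 ≤ ‖M.det‖ := one_le_norm_det_add_I hY
  have hdet0 : 0 < ‖M.det‖ := one_pos.trans_le hdet
  have hadj : ‖M.adjugate i j‖ ≤ ‖M.det‖ := by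
    rw [Matrix.adjugate_fin_two]
    fin_cases i <;> fin_cases j <;> simp only [Fin.zero_eta, Fin.isValue, Fin.mk_one, of_apply, cons_val', cons_val_zero, cons_val_one,
      cons_val_fin_one, empty_val', norm_neg] <;> exact norm_add_I_apply_le_norm_det hY _ _
  rw [Matrix.inv_def, Ring.inverse_eq_inv, Matrix.smul_apply, smul_eq_mul, norm_mul, norm_inv]
  calc ‖M.det‖⁻¹ * ‖M.adjugate i j‖ ≤ ‖M.det‖⁻¹ * ‖M.det‖ := by gcongr
    _ = 1 := inv_mul_cancel₀ hdet0.ne'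

/-! ## §3  A Cholesky factor (`2 × 2`) -/

/-- **CHOLESKY** (`2 × 2`): a positive definite Hermitian `V` is `Bᴴ B` with `det B ≠ 0`
(`V = hermTwo (p, w, q)`, `B = (√p, w∕√p; 0, √ν)`, `ν = (pq − |w|²)∕p`). [folklore] -/
theorem exists_cholesky {V : Matrix (Fin 2) (Fin 2) ℂ} (hV : V.PosDef) :
    ∃ B : Matrix (Fin 2) (Fin 2) ℂ, B.det ≠ 0 ∧ Bᴴ * B = V := by
  have hV' : hermTwo ((V 0 0).re, V 0 1, (V 1 1).re) = V := hermTwo_eq_of_isHermitian hV.1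
  obtain ⟨hp, hpq⟩ := (posDef_hermTwo_iff ((V 0 0).re, V 0 1, (V 1 1).re)).mp (hV'.symm ▸ hV)
  set p : ℝ := (V 0 0).re with hpdef
  set w : ℂ := V 0 1 with hwdef
  set q : ℝ := (V 1 1).re with hqdef
  simp only at hp hpq
  set ν : ℝ := (p * q - Complex.normSq w) / p with hν
  have hνpos : 0 < ν := div_pos (by linarith) hp
  have hsp : 0 < Real.sqrt p := Real.sqrt_pos.mpr hp
  have hsν : 0 < Real.sqrt ν := Real.sqrt_pos.mpr hνpos
  have hspC : ((Real.sqrt p : ℝ) : ℂ) ≠ 0 := by exact_mod_cast hsp.ne'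
  have hsνC : ((Real.sqrt ν : ℝ) : ℂ) ≠ 0 := by exact_mod_cast hsν.ne'
  have hp2 : ((Real.sqrt p : ℝ) : ℂ) * ((Real.sqrt p : ℝ) : ℂ) = (p : ℂ) := by
    rw [← Complex.ofReal_mul, Real.mul_self_sqrt hp.le]
  have hν2 : ((Real.sqrt ν : ℝ) : ℂ) * ((Real.sqrt ν : ℝ) : ℂ) = (ν : ℂ) := by
    rw [← Complex.ofReal_mul, Real.mul_self_sqrt hνpos.le]
  refine ⟨!![((Real.sqrt p : ℝ) : ℂ), w / ((Real.sqrt p : ℝ) : ℂ); 0, ((Real.sqrt ν : ℝ) : ℂ)], ?_, ?_⟩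
  · rw [Matrix.det_fin_two_of, mul_zero, sub_zero]
    exact mul_ne_zero hspC hsνC
  · rw [← hV']
    have hpC : (p : ℂ) ≠ 0 := by exact_mod_cast hp.ne'
    have hwn : conj w * w = ((Complex.normSq w : ℝ) : ℂ) := by rw [mul_comm, Complex.mul_conj]
    ext i j
    fin_cases i <;> fin_cases j
    · simp only [Fin.zero_eta, Fin.isValue, Matrix.mul_apply, Fin.sum_univ_two, conjTranspose_apply, of_apply, cons_val',
        cons_val_zero, cons_val_one, cons_val_fin_one, empty_val', Complex.star_def, Complex.conj_ofReal, map_zero, zero_mul, add_zero,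
        hermTwo_apply_zero_zero]
      exact hp2
    · simp only [Fin.zero_eta, Fin.isValue, Fin.mk_one, Matrix.mul_apply, Fin.sum_univ_two, conjTranspose_apply, of_apply, cons_val',
        cons_val_zero, cons_val_one, cons_val_fin_one, empty_val', Complex.star_def, Complex.conj_ofReal, map_zero, zero_mul, add_zero,
        hermTwo_apply_zero_one]
      field_simp
    · simp only [Fin.mk_one, Fin.isValue, Fin.zero_eta, Matrix.mul_apply, Fin.sum_univ_two, conjTranspose_apply, of_apply, cons_val',
        cons_val_zero, cons_val_one, cons_val_fin_one, empty_val', Complex.star_def, map_div₀, Complex.conj_ofReal, mul_zero, add_zero,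
        hermTwo_apply_one_zero]
      field_simp
    · simp only [Fin.mk_one, Fin.isValue, Matrix.mul_apply, Fin.sum_univ_two, conjTranspose_apply, of_apply, cons_val', cons_val_zero,
        cons_val_one, cons_val_fin_one, empty_val', Complex.star_def, map_div₀, Complex.conj_ofReal, hermTwo_apply_one_one]
      rw [div_mul_div_comm, hwn, hp2, hν2, hν]
      push_cast
      field_simp
      ring

/-! ## §4  Uniform bounds at a tube point `Z = U + iV` -/

/-- The conjugation identity: with `P B = 1 = B P` and `V = Bᴴ B`, `X + U + iV = Bᴴ (Pᴴ (X + U) P + i) B`. [folklore] -/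
theorem add_tube_eq_conj {X U V B P : Matrix (Fin 2) (Fin 2) ℂ} (hBV : Bᴴ * B = V) (hPB : P * B = 1) :
    X + (U + I • V) = Bᴴ * (Pᴴ * (X + U) * P + I • (1 : Matrix (Fin 2) (Fin 2) ℂ)) * B := by
  have hPBh : Bᴴ * Pᴴ = 1 := by rw [← conjTranspose_mul, hPB, conjTranspose_one]
  rw [Matrix.mul_add, Matrix.add_mul, Matrix.mul_smul, Matrix.mul_one, Matrix.smul_mul, hBV]
  have : Bᴴ * (Pᴴ * (X + U) * P) * B = X + U := by
    calc Bᴴ * (Pᴴ * (X + U) * P) * B = (Bᴴ * Pᴴ) * (X + U) * (P * B) := by simp only [Matrix.mul_assoc]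
      _ = X + U := by rw [hPBh, hPB, Matrix.one_mul, Matrix.mul_one]
  rw [this, add_assoc]

/-- `Pᴴ (X + U) P` is Hermitian when `X`, `U` are. [folklore] -/
theorem isHermitian_conj {X U P : Matrix (Fin 2) (Fin 2) ℂ} (hX : X.IsHermitian) (hU : U.IsHermitian) :
    (Pᴴ * (X + U) * P).IsHermitian := by
  have h : (X + U).IsHermitian := hX.add hU
  change (Pᴴ * (X + U) * P)ᴴ = Pᴴ * (X + U) * P
  rw [conjTranspose_mul, conjTranspose_mul, conjTranspose_conjTranspose, h.eq, Matrix.mul_assoc]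

/-- **UNIFORM RESOLVENT BOUND AT A TUBE POINT.**  For `U` Hermitian and `V` positive definite (`2 × 2`) there are `c > 0` and `C ≥ 0` with
`c ≤ |det(X + U + iV)|` and `|((X + U + iV)⁻¹)ᵢⱼ| ≤ C` for EVERY Hermitian `X`.  (`c = |det B|²`, `C = 4β²` with `V = BᴴB` and `β` an entrywise
bound of `B⁻¹`.) [folklore; cf. Shimura1982, (1.26)] -/
theorem exists_resolvent_bound {U V : Matrix (Fin 2) (Fin 2) ℂ} (hU : U.IsHermitian) (hV : V.PosDef) :
    ∃ c C : ℝ, 0 < c ∧ 0 ≤ C ∧ ∀ X : Matrix (Fin 2) (Fin 2) ℂ, X.IsHermitian →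
      c ≤ ‖(X + (U + I • V)).det‖ ∧ ∀ i j, ‖(X + (U + I • V))⁻¹ i j‖ ≤ C := by
  obtain ⟨B, hB0, hBV⟩ := exists_cholesky hV
  have hBu : IsUnit B.det := isUnit_iff_ne_zero.mpr hB0
  set P : Matrix (Fin 2) (Fin 2) ℂ := B⁻¹ with hP
  have hPB : P * B = 1 := Matrix.nonsing_inv_mul B hBu
  have hBP : B * P = 1 := Matrix.mul_nonsing_inv B hBu
  set β : ℝ := ‖P 0 0‖ + ‖P 0 1‖ + ‖P 1 0‖ + ‖P 1 1‖ with hβ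
  have hPβ : ∀ i j, ‖P i j‖ ≤ β := norm_apply_le_sum P
  have hPhβ : ∀ i j, ‖Pᴴ i j‖ ≤ β := norm_conjTranspose_apply_le hPβ
  refine ⟨‖B.det‖ ^ 2, 2 * (2 * β * 1) * β, by positivity, by have := bound_nonneg hPβ; positivity, fun X hX => ?_⟩
  set Y : Matrix (Fin 2) (Fin 2) ℂ := Pᴴ * (X + U) * P with hY
  have hYh : Y.IsHermitian := isHermitian_conj hX hU
  have hconj : X + (U + I • V) = Bᴴ * (Y + I • 1) * B := add_tube_eq_conj hBV hPB
  have hdetY : 1 ≤ ‖(Y + I • (1 : Matrix (Fin 2) (Fin 2) ℂ)).det‖ := one_le_norm_det_add_I hYh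
  have hdet : ‖(X + (U + I • V)).det‖ = ‖B.det‖ ^ 2 * ‖(Y + I • (1 : Matrix (Fin 2) (Fin 2) ℂ)).det‖ := by
    rw [hconj, det_mul, det_mul, det_conjTranspose, norm_mul, norm_mul, Complex.star_def, Complex.norm_conj]
    ring
  refine ⟨?_, fun i j => ?_⟩
  · rw [hdet]
    have h0 : 0 ≤ ‖B.det‖ ^ 2 := by positivity
    nlinarith
  · -- `(X + Z)⁻¹ = P (Y + i)⁻¹ Pᴴ`
    have hYu : IsUnit (Y + I • (1 : Matrix (Fin 2) (Fin 2) ℂ)).det :=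
      isUnit_iff_ne_zero.mpr (norm_pos_iff.mp (one_pos.trans_le hdetY))
    have hinv : (X + (U + I • V))⁻¹ = P * (Y + I • 1)⁻¹ * Pᴴ := by
      refine Matrix.inv_eq_right_inv ?_
      have hBPh : Bᴴ * Pᴴ = 1 := by rw [← conjTranspose_mul, hPB, conjTranspose_one]
      rw [hconj]
      calc Bᴴ * (Y + I • 1) * B * (P * (Y + I • 1)⁻¹ * Pᴴ)
          = Bᴴ * ((Y + I • 1) * ((B * P) * (Y + I • 1)⁻¹)) * Pᴴ := by simp only [Matrix.mul_assoc]
        _ = 1 := by rw [hBP, Matrix.one_mul, Matrix.mul_nonsing_inv _ hYu, Matrix.mul_one, hBPh]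
    rw [hinv]
    exact norm_mul_apply_le (norm_mul_apply_le hPβ (norm_inv_add_I_apply_le_one hYh)) hPhβ i j

/-! ## §5  Perturbation -/

/-- **STABILITY OF THE RESOLVENT BOUND UNDER SMALL PERTURBATIONS OF THE TUBE POINT.**  For `U` Hermitian and `V` positive definite there are
`η > 0` and `C ≥ 0` such that for every Hermitian `X` and every `E` with `|Eᵢⱼ| ≤ η`:
`|det(X + U + iV)| ≤ 4·|det(X + U + iV + E)|` and `|((X + U + iV + E)⁻¹)ᵢⱼ| ≤ C`.
(`X + Z + E = (X + Z)(1 + N)`, `N = (X + Z)⁻¹E`, `|Nᵢⱼ| ≤ ¼`.) [folklore] -/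
theorem exists_resolvent_perturb {U V : Matrix (Fin 2) (Fin 2) ℂ} (hU : U.IsHermitian) (hV : V.PosDef) :
    ∃ η C : ℝ, 0 < η ∧ 0 ≤ C ∧ ∀ X E : Matrix (Fin 2) (Fin 2) ℂ, X.IsHermitian → (∀ i j, ‖E i j‖ ≤ η) →
      ‖(X + (U + I • V)).det‖ ≤ 4 * ‖(X + (U + I • V) + E).det‖ ∧ ∀ i j, ‖(X + (U + I • V) + E)⁻¹ i j‖ ≤ C := by
  obtain ⟨c, C, hc, hC, hres⟩ := exists_resolvent_bound hU hV
  refine ⟨1 / (8 * C + 1), 2 * 5 * C, by positivity, by positivity, fun X E hX hE => ?_⟩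
  obtain ⟨hdet, hinv⟩ := hres X hX
  set M : Matrix (Fin 2) (Fin 2) ℂ := X + (U + I • V) with hM
  have hMu : IsUnit M.det := isUnit_iff_ne_zero.mpr (norm_pos_iff.mp (hc.trans_le hdet))
  set N : Matrix (Fin 2) (Fin 2) ℂ := M⁻¹ * E with hN
  -- `|Nᵢⱼ| ≤ 2·C·η ≤ ¼`
  have hNb : ∀ i j, ‖N i j‖ ≤ 2 * C * (1 / (8 * C + 1)) := norm_mul_apply_le hinv hE
  have hν : 2 * C * (1 / (8 * C + 1)) ≤ 1 / 4 := by
    rw [mul_one_div, div_le_iff₀ (by positivity)]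
    linarith
  have hfac : M + E = M * (1 + N) := by
    rw [Matrix.mul_add, Matrix.mul_one, hN, Matrix.mul_nonsing_inv_cancel_left M E hMu]
  refine ⟨?_, fun i j => ?_⟩
  · rw [hfac, det_mul, norm_mul]
    have h14 := norm_det_one_add_ge hNb hν
    have h0 : 0 ≤ ‖M.det‖ := norm_nonneg _
    nlinarith
  · rw [hfac, Matrix.mul_inv_rev]
    exact norm_mul_apply_le (norm_inv_one_add_apply_le hNb hν) hinv i j

end Summit.HodgeConjecture.HodgeConjecture.Cruxes.HLiu418.K2LiuHermTwoResolventBounds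

end
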